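import Literature.AlgebraicGeometry.Morphisms.CechH1FlatBaseChangeRank
import Literature.AlgebraicGeometry.Morphisms.CechH1LengthTransport
import Literature.AlgebraicGeometry.Morphisms.CechH1AffineCoverIndependence
import Literature.AlgebraicGeometry.AbelianSchemes.AbelianSchemeSpread
import Literature.AlgebraicGeometry.HodgeTheory.ComplexPointsLifting
import Literature.AlgebraicGeometry.HodgeTheory.AbelianVarietyCechH1StructureSheafEqDim
import Mathlib.RingTheory.Flat.Localization
import Mathlib.RingTheory.Flat.Stability
import Mathlib.RingTheory.Localization.Cardinality
import HarnessLib

/-!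
# `dim_K Ȟ¹(𝔘, 𝒪_A) = dim A` for an abelian variety over ANY field `K` of characteristic `0`, by transport from `ℂ`

Layer `Literature/AlgebraicGeometry/AbelianVarieties`, namespace `Literature.AlgebraicGeometry.AbelianVarieties`.
THEOREMS ONLY (no definition, no named fact, no instance, no `sorry`).

[MumfordAV1970] §13 Cor. 2 (p. 129): «`dim H¹(X, 𝒪_X) = g`» for an abelian variety `X` of dimension `g` over an (algebraically closed)
field.  The tree proves it over `ℂ` ANALYTICALLY (★ `HodgeTheory/AbelianVarietyCechH1StructureSheafEqDim.finrank_cechH1_structureSheaf_eq_dim`: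
GAGA + Dolbeault for `≤`, the Kodaira–Spencer map of the Poincaré family for `≥`).  Here it is TRANSPORTED to every field `K` of
characteristic `0` (LEFSCHETZ PRINCIPLE), with no new geometry:

1. SPREAD ([Milne1986AbelianVarieties] §20 Rem. 20.9; [EGAIV3] 8.8.2, [EGAIV4] 17.7.8): `A` is the fibre of an abelian scheme `𝒜 → Spec T′`
   over a finitely generated `ℚ`-DOMAIN `T′ ↪ K` (★ `AbelianSchemes/AbelianSchemeSpread.exists_abelianScheme_relDim_fibre_iso`, `k := ℚ`);
2. EMBED: `Frac T′` is a countable field of characteristic `0`, so it embeds into `ℂ` (★ `HodgeTheory/ComplexPointsLifting.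
   nonempty_ringHom_complex_of_countable`); `A_ℂ := 𝒜 ×_{T′} Spec ℂ` is a complex abelian variety of dimension `dim A`;
3. FLAT BASE CHANGE of Čech `Ȟ¹` in both legs `T′ → K`, `T′ → ℂ` (flat: both factor through `Frac T′`): `K ⊗_{T′} Ȟ¹(𝒜) ≅ Ȟ¹(A)`,
   `ℂ ⊗_{T′} Ȟ¹(𝒜) ≅ Ȟ¹(A_ℂ)` ([StacksProject] 02KH; `Morphisms/CechH1FlatBaseChangeRank.finrank_cechH1_baseChange`), so
   `dim_K Ȟ¹(A) = dim_{Frac T′} (Frac T′ ⊗ Ȟ¹(𝒜)) = dim_ℂ Ȟ¹(A_ℂ) = dim A_ℂ = dim A` (`Module.finrank_baseChange`; finiteness comes OUT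
   of the `ℂ` side, no use of the named fact `Morphisms.cechH1_finite`);
4. cover independence of `Ȟ¹` for affine covers (★ `Morphisms/CechH1AffineCoverIndependence`, [Hartshorne1977] III 4.5) and transport
   along the isomorphism `𝒜_ψ ≅ A` (★ `cechComapH1_bijective_of_isOpenImmersion`).

* `countable_of_finiteType_rat`, `exists_ringHom_complex_injective` — a finitely generated `ℚ`-domain embeds into `ℂ`;
* `finrank_cechH1_fibre_eq` — for an abelian scheme `𝒜/T′`, a FLAT field-valued point `φ : T′ → L` and a finite affine cover `𝔘₀` of `𝒜`:
  `finrank_L Ȟ¹(𝔘₀|_{𝒜_φ}, 𝒪) = finrank_{L} (L ⊗_{T′} Ȟ¹(𝔘₀, 𝒪_𝒜))` (and finiteness iff);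
* **`finrank_cechH1_structureSheaf_eq_dim_of_charZero`** — for `A : AbelianVariety K`, `char K = 0`, and EVERY finite affine open cover
  `𝔘` of `A`: `Module.Finite K Ȟ¹(𝔘, 𝒪_A) ∧ finrank_K Ȟ¹(𝔘, 𝒪_A) = dim A` (the ★ `ℂ` head with `ℂ ↦ K`, token for token).

Cell `hodgecm-mathlib`, F-3 (M-c)(c2) «Lie-count end over a general char-0 field» (the (H1) input of the (M-c) universality spine;
B-plan1 (g19) road ruling (ii) «transport, not re-proof»; B-p07 (g20) census 9fda32d8).  HC_CM is proved only modulo the 7 printed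
citations until rung 0 closes; nothing here is about HC.

## References
* [MumfordAV1970] D. Mumford, *Abelian Varieties* (1970), §13 Cor. 2 (p. 129).
* [Milne1986AbelianVarieties] J. S. Milne, *Abelian Varieties* (1986), §20 Rem. 20.9 («defined over a subfield finitely generated over the prime field»).
* [EGAIV3] A. Grothendieck, J. Dieudonné, EGA IV₃ (1966), Thm. 8.8.2; [StacksProject] Tag 02KH (flat base change), Tag 01ED.
* [Hartshorne1977] R. Hartshorne, *Algebraic Geometry* (1977), III Prop. 9.3 (p. 255), III Thm. 4.5 (p. 222).
-/

set_option autoImplicit false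

noncomputable section

open CategoryTheory CategoryTheory.Limits AlgebraicGeometry TensorProduct Cardinal

namespace Literature.AlgebraicGeometry.AbelianVarieties

open Literature.AlgebraicGeometry.Morphisms Literature.AlgebraicGeometry.AbelianSchemes
  Literature.AlgebraicGeometry.Motives Literature.AlgebraicGeometry.HodgeTheory

/-! ## §1 A finitely generated `ℚ`-domain embeds into `ℂ` -/

/-- An algebra of finite type over `ℚ` is countable (a quotient of a polynomial ring in finitely many variables). [folklore] -/
private theorem countable_of_finiteType_rat (T : Type) [CommRing T] [Algebra ℚ T] [Algebra.FiniteType ℚ T] : Countable T := by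
  obtain ⟨n, g, hg⟩ := Algebra.FiniteType.iff_quotient_mvPolynomial''.mp ‹Algebra.FiniteType ℚ T›
  have hA : #T ≤ ℵ₀ := by
    refine (Cardinal.mk_le_of_surjective hg).trans (MvPolynomial.cardinalMk_le_max_lift.trans ?_)
    exact max_le (max_le (by simp) (by simp)) le_rfl
  exact Cardinal.mk_le_aleph0_iff.mp hA

/-- **A finitely generated `ℚ`-domain embeds into `ℂ`**: its fraction field is a countable field of characteristic `0`, which embeds
into `ℂ` (★ `nonempty_ringHom_complex_of_countable`: a countable transcendence basis injects into one of `ℂ`). The embedding is given on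
the FRACTION FIELD (`σ`), together with its restriction `φ = σ ∘ (T′ → Frac T′)`, injective. [cite: Milne1986AbelianVarieties, §20 Rem. 20.9] -/
theorem exists_ringHom_complex_injective (T : Type) [CommRing T] [IsDomain T] [Algebra ℚ T] [Algebra.FiniteType ℚ T] :
    ∃ σ : FractionRing T →+* ℂ, Function.Injective (σ.comp (algebraMap T (FractionRing T))) := by
  haveI : Countable T := countable_of_finiteType_rat T
  haveI : Countable (FractionRing T) := by
    rw [← Cardinal.mk_le_aleph0_iff, Cardinal.mk_fractionRing]
    exact Cardinal.mk_le_aleph0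
  haveI : CharZero T := charZero_of_injective_algebraMap (algebraMap ℚ T).injective
  haveI : CharZero (FractionRing T) := charZero_of_injective_algebraMap (IsFractionRing.injective T (FractionRing T))
  obtain ⟨σ⟩ := nonempty_ringHom_complex_of_countable (FractionRing T)
  exact ⟨σ, σ.injective.comp (IsFractionRing.injective T (FractionRing T))⟩

/-! ## §2 `Ȟ¹` of a flat field-valued fibre of an abelian scheme over an affine base -/

section Fibre

variable {T : Type} [CommRing T] (𝒜 : AbelianScheme T) {L : Type} [Field L] (φ : T →+* L)

/-- The underlying scheme of an abelian scheme over an affine base is quasi-compact. [folklore] -/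
private theorem abelianScheme_compactSpace_left : CompactSpace 𝒜.X.left :=
  haveI := 𝒜.isProper
  QuasiCompact.compactSpace_of_compactSpace 𝒜.X.hom

/-- The underlying scheme of an abelian scheme over an affine base is quasi-separated. [folklore] -/
private theorem abelianScheme_quasiSeparatedSpace_left : QuasiSeparatedSpace 𝒜.X.left :=
  haveI := 𝒜.isProper
  quasiSeparatedSpace_of_quasiSeparated 𝒜.X.hom

/-- A quasi-compact scheme has a finite affine open cover indexed in `Type`. [folklore] -/
private theorem exists_finite_isAffineOpen_cover_of_compactSpace (X : Scheme.{0}) [CompactSpace X] :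
    ∃ (ι : Type) (_ : Finite ι) (U : ι → X.Opens), (∀ i, IsAffineOpen (U i)) ∧ ⨆ i, U i = ⊤ := by
  obtain ⟨s, hs, e⟩ := (isCompact_iff_finite_and_eq_biUnion_affineOpens (U := (⊤ : X.Opens))).mp
    (by simpa using isCompact_univ)
  haveI := hs.to_subtype
  refine ⟨s, inferInstance, fun i => i.1.1, fun i => i.1.2, ?_⟩
  rw [iSup_subtype]
  exact e.symm

/-- **`Ȟ¹` of a flat field-valued fibre**: for `φ : T′ → L` a field-valued point with `L` FLAT over `T′` and `𝔘₀` a finite affine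
cover of `𝒜`, `finrank_L Ȟ¹(pr₁⁻¹𝔘₀, 𝒪_{𝒜_φ}) = finrank_L (L ⊗_{T′} Ȟ¹(𝔘₀, 𝒪_𝒜))`, and `Ȟ¹(pr₁⁻¹𝔘₀, 𝒪_{𝒜_φ})` is finite over `L`
iff `L ⊗_{T′} Ȟ¹(𝔘₀, 𝒪_𝒜)` is. [cite: StacksProject, Tag 02KH] [cite: Hartshorne1977, III Prop. 9.3 (p. 255)] -/
theorem finrank_cechH1_fibre_eq {ι : Type} [Finite ι] (U₀ : ι → 𝒜.X.left.Opens) (hU₀ : ∀ i, IsAffineOpen (U₀ i))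
    (hflat : letI := φ.toAlgebra; Module.Flat T L) :
    letI := φ.toAlgebra
    Module.finrank L (CechH1 (𝒜.fibre φ).X.hom (preimageFamily (pullback.fst 𝒜.X.hom (AbelianScheme.specMap φ)) U₀)) =
        Module.finrank L (L ⊗[T] CechH1 𝒜.X.hom U₀) ∧
      (Module.Finite L (CechH1 (𝒜.fibre φ).X.hom (preimageFamily (pullback.fst 𝒜.X.hom (AbelianScheme.specMap φ)) U₀)) ↔
        Module.Finite L (L ⊗[T] CechH1 𝒜.X.hom U₀)) := by
  letI := φ.toAlgebra
  haveI : Module.Flat T L := hflat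
  haveI := abelianScheme_quasiSeparatedSpace_left 𝒜
  exact ⟨finrank_cechH1_baseChange 𝒜.X.hom (𝒜.fibre φ).X.hom _ U₀ (AbelianScheme.isPullback_fibre 𝒜 φ) hU₀,
    finite_cechH1_baseChange_iff 𝒜.X.hom (𝒜.fibre φ).X.hom _ U₀ (AbelianScheme.isPullback_fibre 𝒜 φ) hU₀⟩

/-- The preimage of a finite affine cover of `𝒜` in the fibre `𝒜_φ` is a finite affine cover (the projection is affine).
[cite: EGAIV3, Thm. 8.8.2] -/
theorem isAffineOpen_preimageFamily_fibre {ι : Type} (U₀ : ι → 𝒜.X.left.Opens) (hU₀ : ∀ i, IsAffineOpen (U₀ i))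
    (hcov : ⨆ i, U₀ i = ⊤) :
    (∀ i, IsAffineOpen (preimageFamily (pullback.fst 𝒜.X.hom (AbelianScheme.specMap φ)) U₀ i)) ∧
      ⨆ i, preimageFamily (pullback.fst 𝒜.X.hom (AbelianScheme.specMap φ)) U₀ i = ⊤ := by
  haveI : IsAffineHom (pullback.fst 𝒜.X.hom (AbelianScheme.specMap φ)) :=
    MorphismProperty.pullback_fst (P := @IsAffineHom) _ _ inferInstance
  exact ⟨fun i => (hU₀ i).preimage _, (pullback.fst 𝒜.X.hom (AbelianScheme.specMap φ)).iSup_preimage_eq_top hcov⟩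

/-- The fibre of an abelian scheme of relative dimension `g` at a field-valued point has dimension `g`.
[cite: Milne1986AbelianVarieties, §20 Rem. 20.9] -/
theorem dim_fibre_eq {g : ℕ} (h : 𝒜.IsOfRelDim g) : (𝒜.fibre φ).dim = g := by
  have h₁ : (𝒜.baseChange φ).IsOfRelDim (𝒜.fibre φ).dim := (𝒜.baseChange φ).isOfRelDim_dim
  have h₂ : (𝒜.baseChange φ).IsOfRelDim g := h.baseChange φ
  haveI := (𝒜.fibre φ).irreducibleSpace_left
  exact AbelianVarietyProofs.eq_of_smoothOfRelativeDimension (𝒜.fibre φ).X.hom h₁ h₂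

end Fibre

/-! ## §3 Linear algebra: ranks of base changes through a field -/

section Ranks

variable {T : Type} [CommRing T] (F : Type) [Field F] [Algebra T F] (M : Type*) [AddCommGroup M] [Module T M]

/-- For `T → F → L` with `F`, `L` fields: `finrank_L (L ⊗_T M) = finrank_F (F ⊗_T M)`, and `L ⊗_T M` is finite over `L` iff `F ⊗_T M`
is finite over `F` (`L ⊗_T M = L ⊗_F (F ⊗_T M)`, `Module.finrank_baseChange`, `Module.rank_baseChange`). [folklore] -/
private theorem finrank_baseChange_eq_of_tower (L : Type) [Field L] [Algebra T L] [Algebra F L] [IsScalarTower T F L] :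
    Module.finrank L (L ⊗[T] M) = Module.finrank F (F ⊗[T] M) ∧
      (Module.Finite L (L ⊗[T] M) ↔ Module.Finite F (F ⊗[T] M)) := by
  let e : L ⊗[F] (F ⊗[T] M) ≃ₗ[L] L ⊗[T] M := TensorProduct.AlgebraTensorModule.cancelBaseChange T F L L M
  refine ⟨?_, ?_⟩
  · rw [← e.finrank_eq, Module.finrank_baseChange]
  · rw [← Module.rank_lt_aleph0_iff, ← Module.rank_lt_aleph0_iff, ← e.rank_eq, Module.rank_baseChange,
      Cardinal.lift_lt_aleph0]

end Ranks

/-! ## §4 The theorem -/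

/-- **`dim_K Ȟ¹(𝔘, 𝒪_A) = dim A` for an abelian variety over a field of characteristic `0`, on EVERY finite affine open cover `𝔘`**
([MumfordAV1970] §13 Cor. 2), by the Lefschetz principle: spread `A` over a finitely generated `ℚ`-domain `T′ ↪ K` (★ EGA IV 8.8.2 spread of
abelian varieties), embed `Frac T′ ↪ ℂ`, compare both flat base changes of `Ȟ¹(𝒜, 𝒪)` ([StacksProject] 02KH) and read the complex fibre with
the ★ `ℂ`-theorem (Hodge theory). [cite: MumfordAV1970, §13 Cor. 2 (p. 129)] [cite: Milne1986AbelianVarieties, §20 Rem. 20.9]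
[cite: StacksProject, Tag 02KH (flat base change)] [cite: Hartshorne1977, III Prop. 9.3 (p. 255) and III Thm. 4.5 (p. 222)] -/
theorem finrank_cechH1_structureSheaf_eq_dim_of_charZero {K : Type} [Field K] [CharZero K] (A : AbelianVariety K)
    {κ : Type} [Finite κ] (U : κ → A.X.left.Opens) (hU : ∀ i, IsAffineOpen (U i)) (hUcov : iSup U = ⊤) :
    Module.Finite K (CechH1 A.X.hom U) ∧ Module.finrank K (CechH1 A.X.hom U) = A.dim := by
  classical
  -- (1) spread `A` over a finitely generated `ℚ`-domain `T′ ↪ K`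
  obtain ⟨T, _, _, _, _, ψ, hψ₀, 𝒜, -, hdim, ⟨e⟩⟩ :=
    AbelianScheme.exists_abelianScheme_relDim_fibre_iso (k := ℚ) A
  have hψ : Function.Injective ψ.toRingHom := fun x y h => hψ₀ h
  -- (2) embed `Frac T′ ↪ ℂ`
  obtain ⟨σ, hφ⟩ := exists_ringHom_complex_injective T
  set F := FractionRing T
  set φ : T →+* ℂ := σ.comp (algebraMap T F) with hφdef
  -- (3) a finite affine cover of `𝒜` and the `T′`-module `M = Ȟ¹(𝔘₀, 𝒪_𝒜)`
  haveI := abelianScheme_compactSpace_left 𝒜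
  obtain ⟨ι, _, U₀, hU₀, hU₀cov⟩ := exists_finite_isAffineOpen_cover_of_compactSpace 𝒜.X.left
  -- (4) flatness of the two legs through `Frac T′`
  have hflatK : letI := ψ.toRingHom.toAlgebra; Module.Flat T K := by
    letI : Algebra T K := ψ.toRingHom.toAlgebra
    letI : Algebra F K := (IsFractionRing.lift (K := F) (g := ψ.toRingHom) hψ).toAlgebra
    haveI : IsScalarTower T F K := IsScalarTower.of_algebraMap_eq fun x =>
      (IsFractionRing.lift_algebraMap (K := F) (g := ψ.toRingHom) hψ x).symm
    haveI : Module.Flat T F := IsLocalization.flat F (nonZeroDivisors T)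
    exact Module.Flat.trans T F K
  have hflatC : letI := φ.toAlgebra; Module.Flat T ℂ := by
    letI : Algebra T ℂ := φ.toAlgebra
    letI : Algebra F ℂ := σ.toAlgebra
    haveI : IsScalarTower T F ℂ := IsScalarTower.of_algebraMap_eq fun x => rfl
    haveI : Module.Flat T F := IsLocalization.flat F (nonZeroDivisors T)
    exact Module.Flat.trans T F ℂ
  -- (5) the two fibres
  obtain ⟨hKaff, hKcov⟩ := isAffineOpen_preimageFamily_fibre 𝒜 ψ.toRingHom U₀ hU₀ hU₀cov
  obtain ⟨hCaff, hCcov⟩ := isAffineOpen_preimageFamily_fibre 𝒜 φ U₀ hU₀ hU₀cov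
  obtain ⟨hKrk, hKfin⟩ := finrank_cechH1_fibre_eq 𝒜 ψ.toRingHom U₀ hU₀ hflatK
  obtain ⟨hCrk, hCfin⟩ := finrank_cechH1_fibre_eq 𝒜 φ U₀ hU₀ hflatC
  -- (6) the complex fibre: ★ Hodge theory
  obtain ⟨hCfinite, hCdim⟩ := HodgeTheory.AbelianVariety.finrank_cechH1_structureSheaf_eq_dim (𝒜.fibre φ)
    (preimageFamily (pullback.fst 𝒜.X.hom (AbelianScheme.specMap φ)) U₀) hCaff hCcov
  -- (7) ranks through `Frac T′`
  have hTK : letI := ψ.toRingHom.toAlgebra;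
      Module.finrank K (K ⊗[T] CechH1 𝒜.X.hom U₀) = Module.finrank F (F ⊗[T] CechH1 𝒜.X.hom U₀) ∧
        (Module.Finite K (K ⊗[T] CechH1 𝒜.X.hom U₀) ↔ Module.Finite F (F ⊗[T] CechH1 𝒜.X.hom U₀)) := by
    letI : Algebra T K := ψ.toRingHom.toAlgebra
    letI : Algebra F K := (IsFractionRing.lift (K := F) (g := ψ.toRingHom) hψ).toAlgebra
    haveI : IsScalarTower T F K := IsScalarTower.of_algebraMap_eq fun x =>
      (IsFractionRing.lift_algebraMap (K := F) (g := ψ.toRingHom) hψ x).symm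
    exact finrank_baseChange_eq_of_tower F (CechH1 𝒜.X.hom U₀) K
  have hTC : letI := φ.toAlgebra;
      Module.finrank ℂ (ℂ ⊗[T] CechH1 𝒜.X.hom U₀) = Module.finrank F (F ⊗[T] CechH1 𝒜.X.hom U₀) ∧
        (Module.Finite ℂ (ℂ ⊗[T] CechH1 𝒜.X.hom U₀) ↔ Module.Finite F (F ⊗[T] CechH1 𝒜.X.hom U₀)) := by
    letI : Algebra T ℂ := φ.toAlgebra
    letI : Algebra F ℂ := σ.toAlgebra
    haveI : IsScalarTower T F ℂ := IsScalarTower.of_algebraMap_eq fun x => rfl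
    exact finrank_baseChange_eq_of_tower F (CechH1 𝒜.X.hom U₀) ℂ
  -- (8) the fibre at `ψ`: finite of rank `dim A`
  have hKfibre : Module.Finite K (CechH1 (𝒜.fibre ψ.toRingHom).X.hom
      (preimageFamily (pullback.fst 𝒜.X.hom (AbelianScheme.specMap ψ.toRingHom)) U₀)) ∧
      Module.finrank K (CechH1 (𝒜.fibre ψ.toRingHom).X.hom
        (preimageFamily (pullback.fst 𝒜.X.hom (AbelianScheme.specMap ψ.toRingHom)) U₀)) = A.dim := by
    have hfinF : Module.Finite F (F ⊗[T] CechH1 𝒜.X.hom U₀) := hTC.2.mp (hCfin.mp hCfinite)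
    refine ⟨hKfin.mpr (hTK.2.mpr hfinF), ?_⟩
    rw [hKrk, hTK.1, ← hTC.1, ← hCrk, hCdim, dim_fibre_eq 𝒜 φ hdim]
  -- (9) transport along `𝒜_ψ ≅ A` and cover independence
  have hiso : IsIso (AbelianVariety.Hom.toSchemeHom e.hom) :=
    ⟨AbelianVariety.Hom.toSchemeHom e.inv,
      by change AbelianVariety.Hom.toSchemeHom (e.hom ≫ e.inv) = _; rw [e.hom_inv_id]; rfl,
      by change AbelianVariety.Hom.toSchemeHom (e.inv ≫ e.hom) = _; rw [e.inv_hom_id]; rfl⟩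
  set g : (𝒜.fibre ψ.toRingHom).X.left ⟶ A.X.left := AbelianVariety.Hom.toSchemeHom e.hom with hgdef
  haveI : IsIso g := hiso
  have hg : g ≫ A.X.hom = (𝒜.fibre ψ.toRingHom).X.hom := by
    rw [hgdef]; exact Over.w e.hom.hom.hom.hom
  have hsurj : Function.Surjective g.base := (Scheme.homeoOfIso (asIso g)).surjective
  have hbij := cechComapH1_bijective_of_isOpenImmersion A.X.hom (𝒜.fibre ψ.toRingHom).X.hom g hg U
    (fun i x _ => hsurj x)
  let eH : CechH1 A.X.hom U ≃ₗ[K] CechH1 (𝒜.fibre ψ.toRingHom).X.hom (preimageFamily g U) :=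
    LinearEquiv.ofBijective _ hbij
  have hUaff : ∀ i, IsAffineOpen (preimageFamily g U i) := fun i => (hU i).preimage_of_isIso g
  have hUcov' : ⨆ i, preimageFamily g U i = ⊤ := g.iSup_preimage_eq_top hUcov
  obtain ⟨eV⟩ := nonempty_linearEquiv_cechH1_of_isAffineOpen (𝒜.fibre ψ.toRingHom).X.hom (preimageFamily g U)
    (preimageFamily (pullback.fst 𝒜.X.hom (AbelianScheme.specMap ψ.toRingHom)) U₀) hUaff hKaff hUcov' hKcov
  haveI := hKfibre.1
  refine ⟨Module.Finite.equiv (eH.trans eV).symm, ?_⟩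
  rw [(eH.trans eV).finrank_eq, hKfibre.2]

end Literature.AlgebraicGeometry.AbelianVarieties

end
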